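import Summits.CriticalPhenomena.PercolationContinuityZ3.Theorems.PercNearOneGluingNoHeavyLowerTailQ44KernelPeeling

/-!
# The interval parity lemma and minimal-base certificates

Support file for crux `stmt-CriticalPhenomena-4575` (master-family programme, row `Q44`, single-source packing
`g ≥ b1 + h_a`), seat `prim-bnk-1` gen 31; memo `run/shared/lean/prim/prim-l12/FROM-prim-bnk-1-gen31-INTERVAL-PARITY.md`.

**Interval parity lemma (`IntervalParity.exists_odd_of_interval`).**  Let `P ⊆ Q` be finite sets and `𝒱` a family of sets
`T` with `P ⊆ T ⊆ Q` which is UP-CLOSED inside `Q` (`T ∈ 𝒱`, `T ⊆ T' ⊆ Q ⟹ T' ∈ 𝒱`).  Let `𝒴` be any family of subsets of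
`Q` whose RELATIVE COMPLEMENTS `P ∪ (Q \ Y)` all lie in `𝒱`, and suppose that for some `X₀` an odd number of members `Y`
have `Y ∪ P = X₀`.  Then some `T ∈ 𝒱` contains an odd number of members of `𝒴`.
(Linear algebra behind it: for an up-set `𝒱` of the cube `2^E` the GF(2) matrix `[V₁ ∪ V₂ = E]` on `𝒱 × 𝒱` is invertible
with inverse `[#{V ∈ 𝒱 : V ⊆ V₁ ∩ V₂} odd]`; the proof below is the corresponding double count of
`∑_{T ∈ 𝒱} #{Y ⊆ T} · #{V ∈ 𝒱 : V ⊆ T ∩ V₃}` with `V₃ = P ∪ (Q \ X₀)`, carried out in `ZMod 2`.)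

**Minimal-base certificate (`IntervalParity.exists_odd_good_of_minimal_base`).**  Let `𝔊` be an up-set (the goods), `𝒮` a
family, `S₀ ∈ 𝒮` with no other member inside `S₀`, and `Q ⊇ S₀` such that `S₀ ∪ (Q \ S) ∈ 𝔊` for every member `S ⊆ Q`
(for `S = S₀` this says `Q ∈ 𝔊`).  Then some good contains an odd number of members (the lemma on `[S₀, Q]`).
With `Q` the whole fibre this is the symmetric scheme of `…Q44SingleSourceBaseSchemes` read from the MINIMAL member
(kernels `Q \ S` relative to `S₀`); with `Q` a small good above a member it is new — see `…Q44SingleSourceBotW` for the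
application to the single-source cores.  No sorries, no definitions, standard axioms.
-/

namespace Summit.CriticalPhenomena.PercolationContinuityZ3.Theorems

namespace IntervalParity

open Finset

variable {α : Type*} [DecidableEq α]

/-! ## Parity bookkeeping in `ZMod 2` -/

/-- Parity of a Boolean interval: for `A ⊆ B` the number of sets between `A` and `B` (a power of two) is odd iff
`A = B`. [folklore] -/
theorem natCast_card_Icc {A B : Finset α} (h : A ⊆ B) :
    ((#(Finset.Icc A B) : ℕ) : ZMod 2) = if A = B then 1 else 0 := by
  rw [Finset.card_Icc_finset h]
  by_cases hAB : A = B
  · subst hAB; simp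
  · have hlt : #A < #B := Finset.card_lt_card (lt_of_le_of_ne h hAB)
    obtain ⟨j, hj⟩ := Nat.exists_eq_succ_of_ne_zero (show #B - #A ≠ 0 by omega)
    rw [hj, pow_succ, Nat.cast_mul, if_neg hAB]
    have h2 : ((2 : ℕ) : ZMod 2) = 0 := by decide
    rw [h2, mul_zero]

/-! ## The interval parity lemma -/

section Interval

variable (P Q : Finset α) (𝒱 : Finset (Finset α))

/-- In a family up-closed inside `Q`, the members above a member `Z` are exactly the interval `[Z, Q]`. [this work] -/
theorem filter_supset_eq_Icc (h𝒱 : ∀ T ∈ 𝒱, P ⊆ T ∧ T ⊆ Q)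
    (hup : ∀ T ∈ 𝒱, ∀ T' : Finset α, T ⊆ T' → T' ⊆ Q → T' ∈ 𝒱) {Z : Finset α} (hZ : Z ∈ 𝒱) :
    𝒱.filter (fun T => Z ⊆ T) = Finset.Icc Z Q := by
  ext T
  rw [Finset.mem_filter, Finset.mem_Icc]
  constructor
  · rintro ⟨hT, hZT⟩; exact ⟨hZT, (h𝒱 T hT).2⟩
  · rintro ⟨hZT, hTQ⟩; exact ⟨hup Z hZ T hZT hTQ, hZT⟩

/-- Parity of the number of members above a member `Z`: odd iff `Z = Q`. [this work] -/
theorem natCast_card_filter_supset (h𝒱 : ∀ T ∈ 𝒱, P ⊆ T ∧ T ⊆ Q)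
    (hup : ∀ T ∈ 𝒱, ∀ T' : Finset α, T ⊆ T' → T' ⊆ Q → T' ∈ 𝒱) {Z : Finset α} (hZ : Z ∈ 𝒱) :
    ((#(𝒱.filter (fun T => Z ⊆ T)) : ℕ) : ZMod 2) = if Z = Q then 1 else 0 := by
  rw [filter_supset_eq_Icc P Q 𝒱 h𝒱 hup hZ, natCast_card_Icc (h𝒱 Z hZ).2]

/-- The relative complement `P ∪ (Q \ Y)` only depends on `Y ∪ P` (for `Y ⊆ Q`). [this work] -/
theorem union_eq_union_of_relCompl_eq {Y Y' : Finset α} (hY : Y ⊆ Q) (hY' : Y' ⊆ Q)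
    (h : P ∪ (Q \ Y) = P ∪ (Q \ Y')) : Y ∪ P = Y' ∪ P := by
  ext x
  have hx := Finset.ext_iff.1 h x
  simp only [Finset.mem_union, Finset.mem_sdiff] at hx ⊢
  constructor
  · rintro (hxY | hxP)
    · by_cases hxP : x ∈ P
      · exact Or.inr hxP
      · by_contra hc
        have hc' := not_or.1 hc
        have h2 : x ∈ P ∨ x ∈ Q ∧ x ∉ Y' := Or.inr ⟨hY hxY, hc'.1⟩
        rcases hx.2 h2 with h3 | h3
        · exact hxP h3
        · exact h3.2 hxY
    · exact Or.inr hxP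
  · rintro (hxY' | hxP)
    · by_cases hxP : x ∈ P
      · exact Or.inr hxP
      · by_contra hc
        have hc' := not_or.1 hc
        have h2 : x ∈ P ∨ x ∈ Q ∧ x ∉ Y := Or.inr ⟨hY' hxY', hc'.1⟩
        rcases hx.1 h2 with h3 | h3
        · exact hxP h3
        · exact h3.2 hxY'
    · exact Or.inr hxP

/-- For `P ⊆ V ⊆ Q` and `Y ⊆ Q`: `Y ∪ V` covers `Q` iff `V` contains the relative complement `P ∪ (Q \ Y)`. [this work] -/
theorem subset_union_iff_relCompl_subset {Y V : Finset α} (hPV : P ⊆ V) :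
    Q ⊆ Y ∪ V ↔ P ∪ (Q \ Y) ⊆ V := by
  constructor
  · intro h x hx
    rcases Finset.mem_union.1 hx with hxP | hxQY
    · exact hPV hxP
    · rw [Finset.mem_sdiff] at hxQY
      rcases Finset.mem_union.1 (h hxQY.1) with hxY | hxV
      · exact absurd hxY hxQY.2
      · exact hxV
  · intro h x hxQ
    by_cases hxY : x ∈ Y
    · exact Finset.mem_union.2 (Or.inl hxY)
    · exact Finset.mem_union.2 (Or.inr (h (Finset.mem_union.2 (Or.inr (Finset.mem_sdiff.2 ⟨hxQ, hxY⟩)))))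

/-- **Interval parity lemma.**  `𝒱` up-closed inside `Q` with all members in `[P, Q]`; `𝒴` a family of subsets of `Q` whose
relative complements `P ∪ (Q \ Y)` lie in `𝒱`; an odd number of members `Y` with `Y ∪ P = X₀`.  Then some `T ∈ 𝒱`
contains an odd number of members of `𝒴`. [this work] -/
theorem exists_odd_of_interval (𝒴 : Finset (Finset α)) (X₀ : Finset α)
    (h𝒱 : ∀ T ∈ 𝒱, P ⊆ T ∧ T ⊆ Q)
    (hup : ∀ T ∈ 𝒱, ∀ T' : Finset α, T ⊆ T' → T' ⊆ Q → T' ∈ 𝒱)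
    (h𝒴 : ∀ Y ∈ 𝒴, Y ⊆ Q ∧ P ∪ (Q \ Y) ∈ 𝒱)
    (hodd : Odd #(𝒴.filter (fun Y => Y ∪ P = X₀))) :
    ∃ T ∈ 𝒱, Odd #(𝒴.filter (fun Y => Y ⊆ T)) := by
  classical
  by_contra hno
  have heven : ∀ T ∈ 𝒱, Even #(𝒴.filter (fun Y => Y ⊆ T)) := by
    intro T hT
    by_contra h
    exact hno ⟨T, hT, Nat.not_even_iff_odd.1 h⟩
  -- the odd class is inhabited: pick `Y₀` with `Y₀ ∪ P = X₀`, and put `V₃ := P ∪ (Q \ Y₀) ∈ 𝒱`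
  obtain ⟨Y₀, hY₀⟩ : (𝒴.filter (fun Y => Y ∪ P = X₀)).Nonempty := by
    rw [← Finset.card_pos]; exact hodd.pos
  rw [Finset.mem_filter] at hY₀
  set V₃ : Finset α := P ∪ (Q \ Y₀) with hV₃def
  have hV₃ : V₃ ∈ 𝒱 := (h𝒴 Y₀ hY₀.1).2
  -- the double count `Φ = ∑_{T ∈ 𝒱} #{Y ⊆ T} · #{V ∈ 𝒱 : V ⊆ T, V ⊆ V₃}` in `ZMod 2`
  set Φ : ZMod 2 := ∑ T ∈ 𝒱, ((#(𝒴.filter (fun Y => Y ⊆ T)) : ℕ) : ZMod 2) *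
      ((#(𝒱.filter (fun V => V ⊆ T ∧ V ⊆ V₃)) : ℕ) : ZMod 2) with hΦdef
  -- (A) every term vanishes
  have hA : Φ = 0 := by
    refine Finset.sum_eq_zero fun T hT => ?_
    rw [ZMod.natCast_eq_zero_iff_even.2 (heven T hT), zero_mul]
  -- (B) exchange the order of summation
  have hB : Φ = ∑ Y ∈ 𝒴, ∑ V ∈ 𝒱, (if V ⊆ V₃ then (1 : ZMod 2) else 0) *
      ((#(𝒱.filter (fun T => Y ⊆ T ∧ V ⊆ T)) : ℕ) : ZMod 2) := by
    have h1 : ∀ T ∈ 𝒱, ((#(𝒴.filter (fun Y => Y ⊆ T)) : ℕ) : ZMod 2) *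
        ((#(𝒱.filter (fun V => V ⊆ T ∧ V ⊆ V₃)) : ℕ) : ZMod 2) =
        ∑ Y ∈ 𝒴, ∑ V ∈ 𝒱, (if Y ⊆ T then (1 : ZMod 2) else 0) * (if V ⊆ T ∧ V ⊆ V₃ then (1 : ZMod 2) else 0) := by
      intro T _
      rw [Finset.natCast_card_filter, Finset.natCast_card_filter, Finset.sum_mul_sum]
    rw [hΦdef, Finset.sum_congr rfl h1, Finset.sum_comm]
    refine Finset.sum_congr rfl fun Y _ => ?_
    rw [Finset.sum_comm]
    refine Finset.sum_congr rfl fun V _ => ?_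
    rw [Finset.natCast_card_filter, Finset.mul_sum]
    refine Finset.sum_congr rfl fun T _ => ?_
    by_cases h1 : Y ⊆ T <;> by_cases h2 : V ⊆ T <;> by_cases h3 : V ⊆ V₃ <;> simp [h1, h2, h3]
  -- (C) the inner count of `T ⊇ Y ∪ V` is odd iff `Y ∪ V = Q`
  have hC : ∀ Y ∈ 𝒴, ∀ V ∈ 𝒱, ((#(𝒱.filter (fun T => Y ⊆ T ∧ V ⊆ T)) : ℕ) : ZMod 2) =
      if Q ⊆ Y ∪ V then 1 else 0 := by
    intro Y hY V hV
    have hYVQ : Y ∪ V ⊆ Q := Finset.union_subset (h𝒴 Y hY).1 (h𝒱 V hV).2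
    have hYV : Y ∪ V ∈ 𝒱 := hup V hV (Y ∪ V) Finset.subset_union_right hYVQ
    have heq : 𝒱.filter (fun T => Y ⊆ T ∧ V ⊆ T) = 𝒱.filter (fun T => Y ∪ V ⊆ T) :=
      Finset.filter_congr fun T _ => by rw [Finset.union_subset_iff]
    rw [heq, natCast_card_filter_supset P Q 𝒱 h𝒱 hup hYV]
    by_cases hq : Q ⊆ Y ∪ V
    · rw [if_pos (Finset.Subset.antisymm hYVQ hq), if_pos hq]
    · rw [if_neg (fun h => hq (by rw [h])), if_neg hq]
  -- (D) for fixed `Y`, the `V ∈ 𝒱` with `V ⊆ V₃` and `Y ∪ V ⊇ Q` form the interval `[P ∪ (Q \ Y), V₃]`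
  have hD : ∀ Y ∈ 𝒴, ∑ V ∈ 𝒱, (if V ⊆ V₃ then (1 : ZMod 2) else 0) *
      ((#(𝒱.filter (fun T => Y ⊆ T ∧ V ⊆ T)) : ℕ) : ZMod 2) = if Y ∪ P = X₀ then 1 else 0 := by
    intro Y hY
    have h1 : ∑ V ∈ 𝒱, (if V ⊆ V₃ then (1 : ZMod 2) else 0) *
        ((#(𝒱.filter (fun T => Y ⊆ T ∧ V ⊆ T)) : ℕ) : ZMod 2) =
        ∑ V ∈ 𝒱, (if P ∪ (Q \ Y) ⊆ V ∧ V ⊆ V₃ then (1 : ZMod 2) else 0) := by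
      refine Finset.sum_congr rfl fun V hV => ?_
      rw [hC Y hY V hV]
      have hiff : Q ⊆ Y ∪ V ↔ P ∪ (Q \ Y) ⊆ V := subset_union_iff_relCompl_subset P Q (h𝒱 V hV).1
      by_cases h2 : Q ⊆ Y ∪ V <;> by_cases h3 : V ⊆ V₃
      · simp [h2, h3, hiff.1 h2]
      · simp [h2, h3]
      · have h4 : ¬ (P ∪ (Q \ Y) ⊆ V) := fun h => h2 (hiff.2 h)
        simp [h2, h3, h4]
      · simp [h2, h3]
    rw [h1, Finset.sum_boole]
    have hZ : P ∪ (Q \ Y) ∈ 𝒱 := (h𝒴 Y hY).2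
    by_cases hsub : P ∪ (Q \ Y) ⊆ V₃
    · -- the filter is the interval `[P ∪ (Q \ Y), V₃]`
      have heq : 𝒱.filter (fun V => P ∪ (Q \ Y) ⊆ V ∧ V ⊆ V₃) = Finset.Icc (P ∪ (Q \ Y)) V₃ := by
        ext V
        rw [Finset.mem_filter, Finset.mem_Icc]
        constructor
        · rintro ⟨_, h⟩; exact h
        · rintro ⟨h1, h2⟩; exact ⟨hup _ hZ V h1 (h2.trans (h𝒱 V₃ hV₃).2), h1, h2⟩
      rw [heq, natCast_card_Icc hsub]
      by_cases hx : Y ∪ P = X₀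
      · rw [if_pos hx, if_pos]
        rw [hV₃def]
        have : Y₀ ∪ P = Y ∪ P := by rw [hY₀.2, hx]
        ext x; simp only [Finset.mem_union, Finset.mem_sdiff]
        have hx' := Finset.ext_iff.1 this x; simp only [Finset.mem_union] at hx'; tauto
      · rw [if_neg hx, if_neg]
        intro h
        exact hx ((union_eq_union_of_relCompl_eq P Q (h𝒴 Y hY).1 (h𝒴 Y₀ hY₀.1).1 h).trans hY₀.2)
    · have heq : 𝒱.filter (fun V => P ∪ (Q \ Y) ⊆ V ∧ V ⊆ V₃) = ∅ := by
        rw [Finset.filter_eq_empty_iff]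
        rintro V _ ⟨h1, h2⟩
        exact hsub (h1.trans h2)
      rw [heq, Finset.card_empty, Nat.cast_zero, if_neg]
      intro hx
      apply hsub
      rw [hV₃def]
      have : Y₀ ∪ P = Y ∪ P := by rw [hY₀.2, hx]
      intro x hxm
      simp only [Finset.mem_union, Finset.mem_sdiff] at hxm ⊢
      have hx' := Finset.ext_iff.1 this x; simp only [Finset.mem_union] at hx'; tauto
  -- (E) hence `Φ = #{Y : Y ∪ P = X₀} = 1`
  have hE : Φ = 1 := by
    rw [hB, Finset.sum_congr rfl hD, Finset.sum_boole]
    exact ZMod.natCast_eq_one_iff_odd.2 hodd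
  exact zero_ne_one (hA.symm.trans hE)

end Interval

/-! ## Minimal-base certificates -/

/-- **Minimal-base certificate.**  `𝔊` an up-set, `𝒮` a family, `S₀ ∈ 𝒮` containing no other member, `Q ⊇ S₀` with
`S₀ ∪ (Q \ S) ∈ 𝔊` for every member `S ⊆ Q`.  Then some `T ∈ 𝔊` contains an odd number of members of `𝒮`. [this work] -/
theorem exists_odd_good_of_minimal_base [Fintype α] (𝔊 : Finset (Finset α)) (hG : IsUpperSet (𝔊 : Set (Finset α)))
    (𝒮 : Finset (Finset α)) (S₀ Q : Finset α) (hS₀ : S₀ ∈ 𝒮) (hmin : ∀ S ∈ 𝒮, S ⊆ S₀ → S = S₀) (hS₀Q : S₀ ⊆ Q)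
    (hval : ∀ S ∈ 𝒮, S ⊆ Q → S₀ ∪ (Q \ S) ∈ 𝔊) :
    ∃ T ∈ 𝔊, Odd #(𝒮.filter (fun S => S ⊆ T)) := by
  classical
  set 𝒱 : Finset (Finset α) := 𝔊.filter (fun T => S₀ ⊆ T ∧ T ⊆ Q) with h𝒱def
  set 𝒴 : Finset (Finset α) := 𝒮.filter (fun S => S ⊆ Q) with h𝒴def
  have h𝒱 : ∀ T ∈ 𝒱, S₀ ⊆ T ∧ T ⊆ Q := fun T hT => (Finset.mem_filter.1 hT).2
  have hup : ∀ T ∈ 𝒱, ∀ T' : Finset α, T ⊆ T' → T' ⊆ Q → T' ∈ 𝒱 := by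
    intro T hT T' hTT' hT'Q
    rw [Finset.mem_filter] at hT ⊢
    exact ⟨hG hTT' hT.1, hT.2.1.trans hTT', hT'Q⟩
  have h𝒴 : ∀ Y ∈ 𝒴, Y ⊆ Q ∧ S₀ ∪ (Q \ Y) ∈ 𝒱 := by
    intro Y hY
    rw [Finset.mem_filter] at hY
    refine ⟨hY.2, Finset.mem_filter.2 ⟨hval Y hY.1 hY.2, Finset.subset_union_left, ?_⟩⟩
    exact Finset.union_subset hS₀Q Finset.sdiff_subset
  have hodd : Odd #(𝒴.filter (fun Y => Y ∪ S₀ = S₀)) := by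
    have heq : 𝒴.filter (fun Y => Y ∪ S₀ = S₀) = {S₀} := by
      ext S
      rw [Finset.mem_filter, Finset.mem_filter, Finset.mem_singleton, Finset.union_eq_right]
      constructor
      · rintro ⟨⟨hS, _⟩, hsub⟩; exact hmin S hS hsub
      · rintro rfl; exact ⟨⟨hS₀, hS₀Q⟩, Finset.Subset.refl _⟩
    rw [heq, Finset.card_singleton]; exact odd_one
  obtain ⟨T, hT, hTodd⟩ := exists_odd_of_interval S₀ Q 𝒱 𝒴 S₀ h𝒱 hup h𝒴 hodd
  refine ⟨T, (Finset.mem_filter.1 hT).1, ?_⟩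
  have heq : 𝒴.filter (fun Y => Y ⊆ T) = 𝒮.filter (fun S => S ⊆ T) := by
    rw [h𝒴def, Finset.filter_filter]
    exact Finset.filter_congr fun S _ => ⟨fun h => h.2, fun h => ⟨h.trans (h𝒱 T hT).2, h⟩⟩
  rwa [heq] at hTodd

end IntervalParity

end Summit.CriticalPhenomena.PercolationContinuityZ3.Theorems
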